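import Mathlib

/-!
# Pass schemes: a greedy assignment in passes is injective by construction (p5, gen 7)

The abstract form of mine-3's «pass-based canonical scheme» for C-026 (`proofs/MINE3-Q3-gzpass.md`
§2: «each pass serves the not-yet-served bad configurations whose image lies in the designated cell
AND is not yet claimed … later passes only take unclaimed targets ⇒ the whole map is injective»).

A **request** is a source together with its ordered list of candidate targets; a **pass** offers one
request per source; the scheme processes the requests of pass 1, then pass 2, … (`requests`,
pass-major order).  The greedy `step` skips a source that is already served and otherwise gives it
its first candidate that no earlier request has claimed (`pick`); `run` folds the steps.

* `Inv ok st` — the served sources are distinct, the claimed targets are distinct, and every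
  assignment `(x, t)` satisfies `ok x t` (the designated-cell condition);
  **`inv_run`** — the run of any request list keeps the invariant: INJECTIVITY BY CONSTRUCTION;
* `mem_fst_foldl_of_mem` — once served, always served;
* **`card_le_of_complete`**: if every source of `xs` is served by the run and every candidate lies
  in the target set `T`, then `#xs ≤ #T` — the counting conclusion of a complete scheme.

Nothing here is specific to percolation; `C026Pass.lean` instantiates it with the sealed-swap and
edge-adding passes of C-026.
-/

namespace PercRepro

namespace PassScheme

variable {α : Type*} [DecidableEq α]

/-- The first candidate not yet claimed (`used` = the targets claimed so far). -/
def pick (used : List α) : List α → Option α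
  | [] => none
  | t :: ts => if t ∈ used then pick used ts else some t

/-- A picked target is a candidate and is unclaimed. -/
theorem pick_some {used cs : List α} {t : α} (h : pick used cs = some t) : t ∈ cs ∧ t ∉ used := by
  induction cs with
  | nil => simp [pick] at h
  | cons c cs ih =>
    simp only [pick] at h
    split_ifs at h with hc
    · obtain ⟨h1, h2⟩ := ih h
      exact ⟨List.mem_cons_of_mem _ h1, h2⟩
    · obtain rfl := Option.some.inj h
      exact ⟨List.mem_cons_self .., hc⟩

/-- The greedy step on the state `st` (the assignments `(source, target)` made so far, newest first):
a served source is skipped; otherwise the source takes its first unclaimed candidate, if any. -/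
def step (st : List (α × α)) (r : α × List α) : List (α × α) :=
  if r.1 ∈ st.map Prod.fst then st
  else
    match pick (st.map Prod.snd) r.2 with
    | none => st
    | some t => (r.1, t) :: st

/-- The run of a request list: the greedy steps in order, from the empty assignment. -/
def run (rs : List (α × List α)) : List (α × α) := rs.foldl step []

/-- The requests of a pass scheme in pass-major order: every pass offers, to every source of `xs`
in order, its candidate list. -/
def requests (xs : List α) (passes : List (α → List α)) : List (α × List α) :=
  passes.flatMap fun cand => xs.map fun x => (x, cand x)

omit [DecidableEq α] in
/-- Membership in the requests of a scheme. -/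
theorem mem_requests {xs : List α} {passes : List (α → List α)} {r : α × List α} :
    r ∈ requests xs passes ↔ ∃ cand ∈ passes, ∃ x ∈ xs, r = (x, cand x) := by
  simp only [requests, List.mem_flatMap, List.mem_map]
  constructor
  · rintro ⟨cand, hc, x, hx, rfl⟩
    exact ⟨cand, hc, x, hx, rfl⟩
  · rintro ⟨cand, hc, x, hx, rfl⟩
    exact ⟨cand, hc, x, hx, rfl⟩

/-- A step never un-serves a source. -/
theorem mem_fst_step_of_mem {st : List (α × α)} {r : α × List α} {x : α}
    (hx : x ∈ st.map Prod.fst) : x ∈ (step st r).map Prod.fst := by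
  unfold step
  split_ifs with h
  · exact hx
  · split
    · exact hx
    · exact List.mem_cons_of_mem _ hx

/-- Once served, always served. -/
theorem mem_fst_foldl_of_mem (rs : List (α × List α)) {st : List (α × α)} {x : α}
    (hx : x ∈ st.map Prod.fst) : x ∈ (rs.foldl step st).map Prod.fst := by
  induction rs generalizing st with
  | nil => exact hx
  | cons r rs ih => exact ih (mem_fst_step_of_mem hx)

/-- **The invariant**: distinct served sources, distinct claimed targets, and every assignment
allowed by `ok`. -/
structure Inv (ok : α → α → Prop) (st : List (α × α)) : Prop where
  /-- the served sources are distinct -/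
  nodup_fst : (st.map Prod.fst).Nodup
  /-- the claimed targets are distinct -/
  nodup_snd : (st.map Prod.snd).Nodup
  /-- every assignment is allowed -/
  ok : ∀ p ∈ st, ok p.1 p.2

omit [DecidableEq α] in
/-- The empty assignment satisfies the invariant. -/
theorem inv_nil (ok : α → α → Prop) : Inv ok [] :=
  ⟨List.nodup_nil, List.nodup_nil, fun _ h => by simp at h⟩

/-- A step keeps the invariant when the request's candidates are allowed. -/
theorem inv_step {ok : α → α → Prop} {st : List (α × α)} {r : α × List α}
    (hr : ∀ t ∈ r.2, ok r.1 t) (h : Inv ok st) : Inv ok (step st r) := by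
  unfold step
  split_ifs with hx
  · exact h
  · split
    · exact h
    · rename_i t ht
      obtain ⟨htc, htu⟩ := pick_some ht
      refine ⟨?_, ?_, ?_⟩
      · rw [List.map_cons, List.nodup_cons]
        exact ⟨hx, h.nodup_fst⟩
      · rw [List.map_cons, List.nodup_cons]
        exact ⟨htu, h.nodup_snd⟩
      · intro p hp
        rw [List.mem_cons] at hp
        rcases hp with rfl | hp
        · exact hr t htc
        · exact h.ok p hp

/-- A fold of allowed requests keeps the invariant. -/
theorem inv_foldl {ok : α → α → Prop} (rs : List (α × List α))
    (hrs : ∀ r ∈ rs, ∀ t ∈ r.2, ok r.1 t) {st : List (α × α)} (h : Inv ok st) :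
    Inv ok (rs.foldl step st) := by
  induction rs generalizing st with
  | nil => exact h
  | cons r rs ih =>
    exact ih (fun r' hr' => hrs r' (List.mem_cons_of_mem _ hr'))
      (inv_step (hrs r (List.mem_cons_self ..)) h)

/-- **Injectivity by construction**: the run of any allowed request list is an injective partial
assignment into the allowed targets. -/
theorem inv_run {ok : α → α → Prop} (rs : List (α × List α))
    (hrs : ∀ r ∈ rs, ∀ t ∈ r.2, ok r.1 t) : Inv ok (run rs) :=
  inv_foldl rs hrs (inv_nil ok)

/-- **The counting conclusion of a complete scheme**: if every source of `xs` is served by the run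
and every candidate of every request lies in `T`, then `#xs ≤ #T`. -/
theorem card_le_of_complete (xs : List α) (rs : List (α × List α)) (T : Finset α)
    (hT : ∀ r ∈ rs, ∀ t ∈ r.2, t ∈ T) (hcomp : ∀ x ∈ xs, x ∈ (run rs).map Prod.fst) :
    xs.toFinset.card ≤ T.card := by
  have hinv := inv_run (ok := fun _ t => t ∈ T) rs hT
  calc xs.toFinset.card
      ≤ ((run rs).map Prod.fst).toFinset.card := by
        apply Finset.card_le_card
        intro x hx
        rw [List.mem_toFinset] at hx ⊢
        exact hcomp x hx
    _ = ((run rs).map Prod.fst).length := List.toFinset_card_of_nodup hinv.nodup_fst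
    _ = ((run rs).map Prod.snd).length := by rw [List.length_map, List.length_map]
    _ = ((run rs).map Prod.snd).toFinset.card := (List.toFinset_card_of_nodup hinv.nodup_snd).symm
    _ ≤ T.card := by
        apply Finset.card_le_card
        intro t ht
        rw [List.mem_toFinset, List.mem_map] at ht
        obtain ⟨p, hp, rfl⟩ := ht
        exact hinv.ok p hp

end PassScheme

end PercRepro
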